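import Summits.CriticalPhenomena.PercolationContinuityZ3.Theorems.Transplant.SharpnessSeriesLaw
import Summits.CriticalPhenomena.PercolationContinuityZ3.Theorems.Transplant.SharpnessGridPeierls
import Literature.Probability.Percolation.SharpnessDCTProofs
import Literature.Probability.Percolation.KestenTheoremProofs
import Literature.Probability.Percolation.HarrisTheorem
import Literature.Probability.Percolation.BondPercolationSymmetry
import HarnessLib

/-!
# Subcritical decay of the coarse configuration for EVERY mesh with `p^M < ½`

House module of the `TransplantSharpness` programme (sharpness desk; R84-PLAN "sharpness edition").  In the row-83 chain
the mesh `M` has to be large only through the Peierls rate `η = 4 p^M ≤ 1/16` of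
`SharpnessGridPeierls.real_coarsePathEvent_le` (path counting).  Here the same event is bounded for every `M` with
`p^M < ½`: by the SERIES LAW (`bondPercolation_real_preimage_coarseConfig`, `SharpnessSeriesLaw`) the coarse configuration
of `P_p` is `P_{p^M}` on `ℤ²`, which is SUBCRITICAL (`p^M < ½ = p_c(ℤ²)`, Kesten), so the tree's sharpness theorem
(`perc_sharpness_holds`: `P_q(0 ↔ ∂B(n)) ≤ e^{-cn}` for `q < p_c`, Menshikov / Aizenman–Barsky / Duminil-Copin–Tassion) applies:
a self-avoiding open coarse path of length `≥ (2r+1)²` from the origin leaves the box `B(r)` (pigeonhole), hence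
`P_p(coarsePathEvent M ((2r+1)²) 0) ≤ e^{-c r}` (`real_coarsePathEvent_origin_le_exp`).
-/

noncomputable section

namespace Summit.CriticalPhenomena.PercolationContinuityZ3.Theorems.TransplantSharpness

open MeasureTheory Literature.Probability.Percolation Literature.Probability.LatticeModels

/-- **Pigeonhole**: a self-avoiding open coarse path from `0` of length `≥ (2r+1)²` reaches the inner boundary of the
box `B(r)` inside the box, i.e. the coarse configuration lies in the one-arm event `siteToBoundary 2 r`. [folklore] -/
theorem coarsePathEvent_origin_subset_preimage_siteToBoundary (M r : ℕ) :
    coarsePathEvent M ((2 * r + 1) ^ 2) 0 ⊆ coarseConfig M ⁻¹' siteToBoundary 2 r := by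
  classical
  rintro ω ⟨-, y, W, hW, hlen⟩
  -- the path visits `length + 1 > #B(r)` distinct vertices, so one of them lies outside the box
  have hex : ∃ z ∈ W.support, z ∉ box 2 r := by
    by_contra h
    have h' : ∀ z ∈ W.support, z ∈ box 2 r := fun z hz => by_contra fun hz' => h ⟨z, hz, hz'⟩
    have hsub : W.support.toFinset ⊆ box 2 r := fun z hz => h' z (List.mem_toFinset.1 hz)
    have hcard := Finset.card_le_card hsub
    have hnd : W.support.Nodup := hW.support_nodup
    rw [List.card_toFinset, hnd.dedup, SimpleGraph.Walk.length_support, card_box] at hcard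
    omega
  obtain ⟨z, hzW, hzbox⟩ := hex
  -- `0 ↔ z` in the open coarse graph, hence inside `univ`
  have hreach : (openGraph (coarseConfig M ω)).Reachable 0 z := ⟨W.takeUntil z hzW⟩
  have hconn : coarseConfig M ω ∈ openConnIn Set.univ (0 : Site 2) z := openConnIn_univ_of_reachable hreach
  have h0 : (0 : Site 2) ∈ (↑(box 2 r) : Set (Site 2)) := by simp [mem_box]
  obtain ⟨u, w, hu, hw, -, huw, hne, hin⟩ := exists_openConnIn_exit (S := Set.univ) (T := ↑(box 2 r)) h0 hzbox hconn
  refine ⟨u, ?_, ?_⟩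
  · -- `u` is on the inner boundary: its coarse-open neighbour `w` is a lattice neighbour outside the box
    rw [mem_innerBoundary_iff]
    exact ⟨hu, w, hw, (SimpleGraph.mem_edgeSet (zdGraph 2)).1 (coarseConfig_subset_edgeSet M ω huw)⟩
  · simpa [Set.univ_inter] using hin

/-- **Subcritical decay of coarse paths at the origin, for every mesh**: if `p^M < ½` then for some `c > 0` and all `r`,
`P_p(coarsePathEvent M ((2r+1)²) 0) ≤ e^{-c r}` (series law + Kesten's `p_c(ℤ²) = ½` + sharpness of the subcritical phase).
[folklore] -/
theorem real_coarsePathEvent_origin_le_exp {M : ℕ} (p : unitInterval) (hp : (p : ℝ) ^ M < 1 / 2) :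
    ∃ c : ℝ, 0 < c ∧ ∀ r : ℕ,
      (bondPercolation (zdGraph 2) p).real (coarsePathEvent M ((2 * r + 1) ^ 2) 0) ≤ Real.exp (-c * r) := by
  have hq : ((p ^ M : unitInterval) : ℝ) < criticalProb (zdGraph 2) 0 := by
    rw [Set.Icc.coe_pow, kesten_criticalProb_Z2_holds]; exact hp
  obtain ⟨c, hc, hdecay⟩ := DCT16.perc_sharpness_holds (d := 2) le_rfl (p ^ M) hq
  refine ⟨c, hc, fun r => ?_⟩
  calc (bondPercolation (zdGraph 2) p).real (coarsePathEvent M ((2 * r + 1) ^ 2) 0)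
      ≤ (bondPercolation (zdGraph 2) p).real (coarseConfig M ⁻¹' siteToBoundary 2 r) :=
        measureReal_mono (coarsePathEvent_origin_subset_preimage_siteToBoundary M r)
    _ = (bondPercolation (zdGraph 2) (p ^ M)).real (siteToBoundary 2 r) :=
        bondPercolation_real_preimage_coarseConfig p M (DCT16.measurableSet_siteToBoundary 2 r)
    _ ≤ Real.exp (-c * r) := hdecay r

/-! ## Translation to an arbitrary base cell -/

/-- **Coarse-graining commutes with translations**: shifting the configuration by `M v` shifts the coarse configuration by
`v`. [folklore] -/
theorem coarseConfig_relabel_shift (M : ℕ) (v : Site 2) (ω : BondConfig (Site 2)) :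
    coarseConfig M (BondConfig.relabel (sym2Equiv (Site.shift ((M : ℤ) • v))) ω) =
      BondConfig.relabel (sym2Equiv (Site.shift v)) (coarseConfig M ω) := by
  -- a wall edge of the cell `x` is the wall edge of the cell `x - v`, shifted by `M v`
  have hwall : ∀ (x : Site 2) (j : Fin 2) (t : ℕ),
      wallEdge M x j t = sym2Equiv (Site.shift ((M : ℤ) • v)) (wallEdge M (x - v) j t) := by
    intro x j t
    rw [wallEdge, wallEdge, sym2Equiv_mk, Site.shift_apply, Site.shift_apply, smul_sub]
    congr 1 <;> abel
  have hrel : ∀ z : Sym2 (Site 2), sym2Equiv (Site.shift ((M : ℤ) • v)) z ∈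
      BondConfig.relabel (sym2Equiv (Site.shift ((M : ℤ) • v))) ω ↔ z ∈ ω := fun z => by
    rw [BondConfig.mem_relabel_iff, Equiv.symm_apply_apply]
  ext e
  induction e using Sym2.ind with
  | h a b =>
    rw [BondConfig.mem_relabel_iff, sym2Equiv_symm, sym2Equiv_mk, Site.shift_symm_apply, Site.shift_symm_apply]
    constructor
    · rintro ⟨x, j, hxj, hw⟩
      refine ⟨x - v, j, ?_, fun t ht => ?_⟩
      · have h1 : s(a - v, b - v) = sym2Equiv (Site.shift v).symm s(a, b) := by
          rw [sym2Equiv_mk, Site.shift_symm_apply, Site.shift_symm_apply]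
        rw [h1, hxj, sym2Equiv_mk, Site.shift_symm_apply, Site.shift_symm_apply]
        congr 1; abel
      · have h2 := hw t ht
        rwa [hwall x j t, hrel] at h2
    · rintro ⟨x, j, hxj, hw⟩
      refine ⟨x + v, j, ?_, fun t ht => ?_⟩
      · have h1 : s(a, b) = sym2Equiv (Site.shift v) s(a - v, b - v) := by
          rw [sym2Equiv_mk, Site.shift_apply, Site.shift_apply]; congr 1 <;> abel
        rw [h1, hxj, sym2Equiv_mk, Site.shift_apply, Site.shift_apply]
        congr 1; abel
      · rw [hwall (x + v) j t, add_sub_cancel_right, hrel]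
        exact hw t ht

/-- The open coarse graph of the shifted configuration is the shifted open coarse graph (a graph isomorphism). -/
def coarseShiftIso (M : ℕ) (v : Site 2) (ω : BondConfig (Site 2)) :
    openGraph (coarseConfig M ω) ≃g openGraph (coarseConfig M (BondConfig.relabel (sym2Equiv (Site.shift ((M : ℤ) • v))) ω)) where
  toEquiv := Site.shift v
  map_rel_iff' := by
    intro a b
    rw [coarseConfig_relabel_shift]
    exact openGraph_relabel_adj_iff (Site.shift v) (coarseConfig M ω) a b

/-- **Translating the base cell**: the coarse path event at `x` is the coarse path event at `0` for the configuration shifted by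
`-M x`. [folklore] -/
theorem coarsePathEvent_subset_preimage_shift (M n : ℕ) (x : Site 2) :
    coarsePathEvent M n x ⊆
      BondConfig.relabel (sym2Equiv (Site.shift ((M : ℤ) • (-x)))) ⁻¹' coarsePathEvent M n 0 := by
  rintro ω ⟨hω, y, W, hW, hlen⟩
  refine ⟨?_, ?_⟩
  · -- the shifted configuration still lives on lattice edges
    intro z hz
    rw [BondConfig.mem_relabel_iff] at hz
    let φ : zdGraph 2 ≃g zdGraph 2 :=
      { toEquiv := Site.shift ((M : ℤ) • (-x)), map_rel_iff' := fun {a b} => zdGraph_adj_shift_iff _ a b }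
    have h1 : sym2Equiv φ.toEquiv ((sym2Equiv (Site.shift ((M : ℤ) • -x))).symm z) ∈ (zdGraph 2).edgeSet :=
      (sym2Equiv_mem_edgeSet_iff φ _).2 (hω hz)
    have h2 : sym2Equiv φ.toEquiv ((sym2Equiv (Site.shift ((M : ℤ) • -x))).symm z) = z :=
      Equiv.apply_symm_apply (sym2Equiv (Site.shift ((M : ℤ) • -x))) z
    rwa [h2] at h1
  · let ψ := coarseShiftIso M (-x) ω
    have hx0 : ψ.toHom x = 0 := by
      show Site.shift (-x) x = 0
      rw [Site.shift_apply, add_neg_cancel]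
    refine ⟨ψ y, (W.map ψ.toHom).copy hx0 rfl, ?_, ?_⟩
    · rw [SimpleGraph.Walk.isPath_copy, SimpleGraph.Walk.isPath_map_iff_of_injective ψ.injective]
      exact hW
    · rw [SimpleGraph.Walk.length_copy, SimpleGraph.Walk.length_map]
      exact hlen

/-- **Subcritical decay of coarse paths from every cell, for every mesh**: if `p^M < ½` then for some `c > 0`, all `r` and
all base cells `x`, `P_p(coarsePathEvent M ((2r+1)²) x) ≤ e^{-c r}` (translation invariance of `P_p` + the origin case).
[folklore] -/
theorem real_coarsePathEvent_le_exp {M : ℕ} (p : unitInterval) (hp : (p : ℝ) ^ M < 1 / 2) :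
    ∃ c : ℝ, 0 < c ∧ ∀ (r : ℕ) (x : Site 2),
      (bondPercolation (zdGraph 2) p).real (coarsePathEvent M ((2 * r + 1) ^ 2) x) ≤ Real.exp (-c * r) := by
  obtain ⟨c, hc, h0⟩ := real_coarsePathEvent_origin_le_exp p hp
  refine ⟨c, hc, fun r x => ?_⟩
  calc (bondPercolation (zdGraph 2) p).real (coarsePathEvent M ((2 * r + 1) ^ 2) x)
      ≤ (bondPercolation (zdGraph 2) p).real
          (BondConfig.relabel (sym2Equiv (Site.shift ((M : ℤ) • (-x)))) ⁻¹' coarsePathEvent M ((2 * r + 1) ^ 2) 0) :=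
        measureReal_mono (coarsePathEvent_subset_preimage_shift M _ x)
    _ = (bondPercolation (zdGraph 2) p).real (coarsePathEvent M ((2 * r + 1) ^ 2) 0) :=
        bondPercolation_real_preimage_shift _ p _
    _ ≤ Real.exp (-c * r) := h0 r

end Summit.CriticalPhenomena.PercolationContinuityZ3.Theorems.TransplantSharpness
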